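import Summits.ValiantsHypothesis.ValiantsHypothesis.Theorems.LacunarySymmetroidMatrixDescartesFiniteSectorPairSumMasks

/-!
# `MatrixDescartes` — line «finite»: the SECTOR CEILING `η(2,7) ≤ σ(2,7) = 40` (kernel) — `HypRootLawAt 2 7 40`, Conjecture Σ's value
# `2·n(2,6)` at the cell `(2,7)`

HONEST FRAMING.  Object-search cell `pub-symmetroid`, seat val-sym-door-p5 g8 (the `m = 2` row of the finite table was left to a door-p5 seat, desk
R2488 (A) / R2525 (B)(ii)).  HELPER of the crux item `stmt-ValiantsHypothesis-18050` (`Theses.LacunarySymmetroid.MatrixDescartes`) with NO closure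
claim.  Continuation of `…FiniteSectorSectorCeilingMTwo` (`HypRootLawAt 2 K 2·n(2,K−1)` for `K ≤ 6`): the SIEVE of line «finite»
(`FiniteSector.sieve`, `natDegree_mem_sumset`) makes the pair sums `dᵢ + dⱼ` of an in-sector pencil a step-≤-2 chain from `0` up to the degree;
the finite core — no `6` positive values carry such a chain beyond `40` — is a PRUNED NESTED enumeration decided in the kernel, now with the
pair-sum set carried as a `Nat` BITMASK (`…FiniteSectorPairSumMasks`: atoms `(P ||| P/2) % 2^t = 2^t − 1`), which is what makes `K = 7`
({live nodes} live prefixes) one kernel check.  Result: `hypRootLawAt_two_seven_40 : HypRootLawAt 2 7 40`.  Located first (exact DFS, this seat,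
HOME/val-sym-door-p5/g8/work/mask/psenum.py): the chain survives to `39` only on {finals} value sets, among them the doubled extremal stamp bases, and
on none of them is `41` a pair sum or are `40` and `42` both pair sums — `σ(2,7) = 40 = 2·n(2,6)`, Conjecture Σ of `Lines/finite.md` at the cell
`(2,7)`; the lower side `η(2,7) ≥ 40` needs a realised doubled `A_6` row and is NOT claimed here.  Nothing here bears on the crux (asymptotic),
on `H3`, on the doors, or on `VP ≠ VNP`.
[folklore] Gap-rule / sieve bookkeeping plus a finite enumeration (two-stamp postage numbers, OEIS A001212); no citation is load-bearing.
-/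

-- `Summit.ValiantsHypothesis.ValiantsHypothesis.…` repeats a component by the D-0017 layout
-- (single-conjunct summit), which the `dupNamespace` linter flags; the name is mandated.
set_option linter.dupNamespace false

namespace Summit.ValiantsHypothesis.ValiantsHypothesis.Theorems.LacunarySymmetroidMatrixDescartes.FiniteSector

open scoped BigOperators Matrix
open Polynomial

/-! ## `K = 7`: `σ(2,7) = 40` -/

set_option synthInstance.maxSize 2000000 in
set_option synthInstance.maxHeartbeats 2000000 in
set_option maxHeartbeats 4000000 in
/-- **Finite core of `σ(2,7) = 40`** (pruned nested enumeration over sorted positive values `< 44`, pair sums as bitmasks, `decide` in the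
kernel): if every sorted prefix keeps the step-≤-2 pair-sum chain alive below the next value and the chain of the whole set reaches `39`,
then `41` is NOT a pair sum and `40`, `42` are not BOTH pair sums. [folklore] -/
theorem sectorCheck_two_seven :
    ∀ a ∈ List.range 44, (0 < a ∧ ((List.foldr (fun x acc => List.foldr (fun y acc => acc ||| 2 ^ (x + y)) acc [0]) 0 [0] ||| List.foldr (fun x acc => List.foldr (fun y acc => acc ||| 2 ^ (x + y)) acc [0]) 0 [0] / 2) % 2 ^ (min 40 (a - 1)) = 2 ^ (min 40 (a - 1)) - 1)) →
    ∀ b ∈ List.range 44, (a < b ∧ ((List.foldr (fun x acc => List.foldr (fun y acc => acc ||| 2 ^ (x + y)) acc [0, a]) 0 [0, a] ||| List.foldr (fun x acc => List.foldr (fun y acc => acc ||| 2 ^ (x + y)) acc [0, a]) 0 [0, a] / 2) % 2 ^ (min 40 (b - 1)) = 2 ^ (min 40 (b - 1)) - 1)) →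
    ∀ c ∈ List.range 44, (b < c ∧ ((List.foldr (fun x acc => List.foldr (fun y acc => acc ||| 2 ^ (x + y)) acc [0, a, b]) 0 [0, a, b] ||| List.foldr (fun x acc => List.foldr (fun y acc => acc ||| 2 ^ (x + y)) acc [0, a, b]) 0 [0, a, b] / 2) % 2 ^ (min 40 (c - 1)) = 2 ^ (min 40 (c - 1)) - 1)) →
    ∀ e ∈ List.range 44, (c < e ∧ ((List.foldr (fun x acc => List.foldr (fun y acc => acc ||| 2 ^ (x + y)) acc [0, a, b, c]) 0 [0, a, b, c] ||| List.foldr (fun x acc => List.foldr (fun y acc => acc ||| 2 ^ (x + y)) acc [0, a, b, c]) 0 [0, a, b, c] / 2) % 2 ^ (min 40 (e - 1)) = 2 ^ (min 40 (e - 1)) - 1)) →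
    ∀ f ∈ List.range 44, (e < f ∧ ((List.foldr (fun x acc => List.foldr (fun y acc => acc ||| 2 ^ (x + y)) acc [0, a, b, c, e]) 0 [0, a, b, c, e] ||| List.foldr (fun x acc => List.foldr (fun y acc => acc ||| 2 ^ (x + y)) acc [0, a, b, c, e]) 0 [0, a, b, c, e] / 2) % 2 ^ (min 40 (f - 1)) = 2 ^ (min 40 (f - 1)) - 1)) →
    ∀ g ∈ List.range 44, (f < g ∧ ((List.foldr (fun x acc => List.foldr (fun y acc => acc ||| 2 ^ (x + y)) acc [0, a, b, c, e, f]) 0 [0, a, b, c, e, f] ||| List.foldr (fun x acc => List.foldr (fun y acc => acc ||| 2 ^ (x + y)) acc [0, a, b, c, e, f]) 0 [0, a, b, c, e, f] / 2) % 2 ^ (min 40 (g - 1)) = 2 ^ (min 40 (g - 1)) - 1)) →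
    (((List.foldr (fun x acc => List.foldr (fun y acc => acc ||| 2 ^ (x + y)) acc [0, a, b, c, e, f, g]) 0 [0, a, b, c, e, f, g] ||| List.foldr (fun x acc => List.foldr (fun y acc => acc ||| 2 ^ (x + y)) acc [0, a, b, c, e, f, g]) 0 [0, a, b, c, e, f, g] / 2) % 2 ^ 40 = 2 ^ 40 - 1) →
      ((List.foldr (fun x acc => List.foldr (fun y acc => acc ||| 2 ^ (x + y)) acc [0, a, b, c, e, f, g]) 0 [0, a, b, c, e, f, g]).testBit 41 = false ∧ ((List.foldr (fun x acc => List.foldr (fun y acc => acc ||| 2 ^ (x + y)) acc [0, a, b, c, e, f, g]) 0 [0, a, b, c, e, f, g]).testBit 40 = false ∨ (List.foldr (fun x acc => List.foldr (fun y acc => acc ||| 2 ^ (x + y)) acc [0, a, b, c, e, f, g]) 0 [0, a, b, c, e, f, g]).testBit 42 = false))) := by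
  decide +kernel

/-- **`η(2,7) ≤ 40 = σ(2,7)`** — `HypRootLawAt 2 7 40`: every in-sector (`#distinct real roots = natDegree`) determinant of a real symmetric
`2 × 2` lacunary pencil with `7` terms has degree `≤ 40`.  (SIEVE ⇒ pair-sum chain; values capped at `43`, value set padded to `7` distinct
values and sorted; prefix pruning `memP_prefix`; masks `…PairSumMasks`; `sectorCheck_two_seven`.) [folklore] -/
theorem hypRootLawAt_two_seven_40 : HypRootLawAt 2 7 40 := by
  intro d S hS hsec
  by_contra hdeg'
  have hdeg : 40 < (pencil d S).det.natDegree := not_le.mp hdeg'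
  have hq : (pencil d S).det ≠ 0 := by
    intro h0
    rw [h0] at hdeg
    simp at hdeg
  -- pair sums of exponents
  have hpair : ∀ r, r ∈ (Finset.univ : Finset (Sym (Fin 7) 2)).image
      (fun s : Sym (Fin 7) 2 => ((s : Multiset (Fin 7)).map d).sum) → ∃ i j : Fin 7, d i + d j = r := by
    intro r hr
    rw [Finset.mem_image] at hr
    obtain ⟨s, -, hs⟩ := hr
    have hcard2 : Multiset.card (s : Multiset (Fin 7)) = 2 := s.2
    obtain ⟨i, j, hij⟩ := Multiset.card_eq_two.mp hcard2
    refine ⟨i, j, ?_⟩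
    have hsum : ((s : Multiset (Fin 7)).map d).sum = d i + d j := by
      rw [hij]
      simp
    omega
  have hchain : ∀ r, r + 2 ≤ (pencil d S).det.natDegree →
      (∃ i j : Fin 7, d i + d j = r) ∨ (∃ i j : Fin 7, d i + d j = r + 1) := by
    intro r hr
    rcases sieve d S hq hsec hr with h | h
    · exact Or.inl (hpair _ h)
    · exact Or.inr (hpair _ h)
  have htop : ∃ i j : Fin 7, d i + d j = (pencil d S).det.natDegree := hpair _ (natDegree_mem_sumset d S hq)
  -- capped values, the value set, padding, sorting
  set cv : Fin 7 → ℕ := fun i => min (d i) 43 with hcv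
  have hcvd : ∀ i, d i ≤ 42 → cv i = d i := fun i hi => by
    simp only [hcv]
    exact Nat.min_eq_left (by omega)
  have hcvle : ∀ i, cv i ≤ 43 := fun i => Nat.min_le_right _ _
  set V : Finset ℕ := Finset.univ.image cv with hV
  have hcvV : ∀ i, cv i ∈ V := fun i => Finset.mem_image_of_mem cv (Finset.mem_univ i)
  have h0V : 0 ∈ V := by
    rcases hchain 0 (by omega) with ⟨i, j, hij⟩ | ⟨i, j, hij⟩
    · have : cv i = 0 := by rw [hcvd i (by omega)]; omega
      exact this ▸ hcvV i
    · rcases Nat.eq_zero_or_pos (d i) with hi | hi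
      · have : cv i = 0 := by rw [hcvd i (by omega)]; omega
        exact this ▸ hcvV i
      · have : cv j = 0 := by rw [hcvd j (by omega)]; omega
        exact this ▸ hcvV j
  set W : Finset ℕ := V.erase 0 with hW
  have hWsub : W ⊆ (Finset.range 44).erase 0 := by
    intro u hu
    rw [hW, Finset.mem_erase] at hu
    obtain ⟨hu0, huV⟩ := hu
    rw [hV, Finset.mem_image] at huV
    obtain ⟨i, -, rfl⟩ := huV
    rw [Finset.mem_erase, Finset.mem_range]
    exact ⟨hu0, Nat.lt_succ_of_le (hcvle i)⟩
  have hWcard : W.card ≤ 6 := by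
    have hVK : V.card ≤ 7 := by
      have := Finset.card_image_le (s := (Finset.univ : Finset (Fin 7))) (f := cv)
      simpa using this
    have h1 : W.card + 1 = V.card := by rw [hW]; exact Finset.card_erase_add_one h0V
    omega
  obtain ⟨W', hWW', hW'sub, hW'card⟩ := Finset.exists_subsuperset_card_eq hWsub hWcard
    (by rw [Finset.card_erase_of_mem (by simp), Finset.card_range]; omega)
  have hVW' : ∀ u ∈ V, u = 0 ∨ u ∈ W' := by
    intro u hu
    by_cases hu0 : u = 0
    · exact Or.inl hu0
    · exact Or.inr (hWW' (by rw [hW, Finset.mem_erase]; exact ⟨hu0, hu⟩))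
  have hlmem : ∀ u, u ∈ Finset.sort W' ↔ u ∈ W' := fun u => Finset.mem_sort _
  have hlsort : (Finset.sort W').SortedLT := Finset.sortedLT_sort W'
  have hllen : (Finset.sort W').length = 6 := by rw [Finset.length_sort, hW'card]
  generalize hl : Finset.sort W' = l at hlmem hlsort hllen
  -- name the sorted values
  rcases l with _ | ⟨a, _ | ⟨b, _ | ⟨c, _ | ⟨e, _ | ⟨f, _ | ⟨g, _ | ⟨zz, ll⟩⟩⟩⟩⟩⟩⟩
  all_goals simp only [List.length_cons, List.length_nil] at hllen
  all_goals try omega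
  -- bounds and order
  have hmemR : ∀ u, u ∈ [a, b, c, e, f, g] → u ∈ List.range 44 := by
    intro u hu
    have hu' : u ∈ W' := (hlmem u).mp hu
    have := hW'sub hu'
    rw [Finset.mem_erase, Finset.mem_range] at this
    exact List.mem_range.mpr this.2
  have hne0 : ∀ u, u ∈ [a, b, c, e, f, g] → u ≠ 0 := by
    intro u hu
    have hu' : u ∈ W' := (hlmem u).mp hu
    have := hW'sub hu'
    rw [Finset.mem_erase] at this
    exact this.1
  have h0 : 0 < a := Nat.pos_of_ne_zero (hne0 a (by simp))
  -- membership transfer: a pair sum `r ≤ 42` of `d` is a pair sum of the sorted value list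
  have hmemP : ∀ r, r ≤ 42 → (∃ i j : Fin 7, d i + d j = r) → (∃ x ∈ [0, a, b, c, e, f, g], ∃ y ∈ [0, a, b, c, e, f, g], x + y = r) := by
    rintro r hr ⟨i, j, hij⟩
    have hi : cv i = d i := hcvd i (by omega)
    have hj : cv j = d j := hcvd j (by omega)
    have hin : ∀ u ∈ V, u ∈ [0, a, b, c, e, f, g] := by
      intro u hu
      rcases hVW' u hu with h | h
      · rw [h]; simp
      · exact List.mem_cons_of_mem _ ((hlmem u).mpr h)
    exact ⟨cv i, hin _ (hcvV i), cv j, hin _ (hcvV j), by rw [hi, hj]; exact hij⟩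
  have hchainP : ∀ r, r ≤ 39 → (∃ x ∈ [0, a, b, c, e, f, g], ∃ y ∈ [0, a, b, c, e, f, g], x + y = r) ∨ (∃ x ∈ [0, a, b, c, e, f, g], ∃ y ∈ [0, a, b, c, e, f, g], x + y = r + 1) := by
    intro r hr
    rcases hchain r (by omega) with h | h
    · exact Or.inl (hmemP r (by omega) h)
    · exact Or.inr (hmemP (r + 1) (by omega) h)
  have hfull : ((List.foldr (fun x acc => List.foldr (fun y acc => acc ||| 2 ^ (x + y)) acc [0, a, b, c, e, f, g]) 0 [0, a, b, c, e, f, g] ||| List.foldr (fun x acc => List.foldr (fun y acc => acc ||| 2 ^ (x + y)) acc [0, a, b, c, e, f, g]) 0 [0, a, b, c, e, f, g] / 2) % 2 ^ 40 = 2 ^ 40 - 1) := by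
    apply maskAlive_of_testBit
    intro r hr
    rcases hchainP r (by omega) with h | h
    · exact Or.inl (testBit_pairFold_of_mem h)
    · exact Or.inr (testBit_pairFold_of_mem h)
  have hlt1 : a < b := by
    have := hlsort (show (⟨0, by simp⟩ : Fin [a, b, c, e, f, g].length) < ⟨1, by simp⟩ from Fin.mk_lt_mk.mpr (by norm_num))
    simpa using this
  have hlt2 : b < c := by
    have := hlsort (show (⟨1, by simp⟩ : Fin [a, b, c, e, f, g].length) < ⟨2, by simp⟩ from Fin.mk_lt_mk.mpr (by norm_num))
    simpa using this
  have hlt3 : c < e := by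
    have := hlsort (show (⟨2, by simp⟩ : Fin [a, b, c, e, f, g].length) < ⟨3, by simp⟩ from Fin.mk_lt_mk.mpr (by norm_num))
    simpa using this
  have hlt4 : e < f := by
    have := hlsort (show (⟨3, by simp⟩ : Fin [a, b, c, e, f, g].length) < ⟨4, by simp⟩ from Fin.mk_lt_mk.mpr (by norm_num))
    simpa using this
  have hlt5 : f < g := by
    have := hlsort (show (⟨4, by simp⟩ : Fin [a, b, c, e, f, g].length) < ⟨5, by simp⟩ from Fin.mk_lt_mk.mpr (by norm_num))
    simpa using this
  have pre1 : ((List.foldr (fun x acc => List.foldr (fun y acc => acc ||| 2 ^ (x + y)) acc [0]) 0 [0] ||| List.foldr (fun x acc => List.foldr (fun y acc => acc ||| 2 ^ (x + y)) acc [0]) 0 [0] / 2) % 2 ^ (min 40 (a - 1)) = 2 ^ (min 40 (a - 1)) - 1) := by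
    apply maskAlive_of_testBit
    intro r hr
    have hrT : r < 40 := lt_of_lt_of_le hr (min_le_left _ _)
    have hrv : r < a - 1 := lt_of_lt_of_le hr (min_le_right _ _)
    have hr' : r + 1 < a := by omega
    have hrest : ∀ y ∈ [a, b, c, e, f, g], a ≤ y := by
      intro y hy
      simp only [List.mem_cons, List.mem_nil_iff, or_false] at hy
      omega
    rcases hchainP r (by omega) with h | h
    · exact Or.inl (testBit_pairFold_of_mem (memP_prefix (l₁ := [0]) (l₂ := [a, b, c, e, f, g]) hrest (by omega) h))
    · exact Or.inr (testBit_pairFold_of_mem (memP_prefix (l₁ := [0]) (l₂ := [a, b, c, e, f, g]) hrest hr' h))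
  have pre2 : ((List.foldr (fun x acc => List.foldr (fun y acc => acc ||| 2 ^ (x + y)) acc [0, a]) 0 [0, a] ||| List.foldr (fun x acc => List.foldr (fun y acc => acc ||| 2 ^ (x + y)) acc [0, a]) 0 [0, a] / 2) % 2 ^ (min 40 (b - 1)) = 2 ^ (min 40 (b - 1)) - 1) := by
    apply maskAlive_of_testBit
    intro r hr
    have hrT : r < 40 := lt_of_lt_of_le hr (min_le_left _ _)
    have hrv : r < b - 1 := lt_of_lt_of_le hr (min_le_right _ _)
    have hr' : r + 1 < b := by omega
    have hrest : ∀ y ∈ [b, c, e, f, g], b ≤ y := by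
      intro y hy
      simp only [List.mem_cons, List.mem_nil_iff, or_false] at hy
      omega
    rcases hchainP r (by omega) with h | h
    · exact Or.inl (testBit_pairFold_of_mem (memP_prefix (l₁ := [0, a]) (l₂ := [b, c, e, f, g]) hrest (by omega) h))
    · exact Or.inr (testBit_pairFold_of_mem (memP_prefix (l₁ := [0, a]) (l₂ := [b, c, e, f, g]) hrest hr' h))
  have pre3 : ((List.foldr (fun x acc => List.foldr (fun y acc => acc ||| 2 ^ (x + y)) acc [0, a, b]) 0 [0, a, b] ||| List.foldr (fun x acc => List.foldr (fun y acc => acc ||| 2 ^ (x + y)) acc [0, a, b]) 0 [0, a, b] / 2) % 2 ^ (min 40 (c - 1)) = 2 ^ (min 40 (c - 1)) - 1) := by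
    apply maskAlive_of_testBit
    intro r hr
    have hrT : r < 40 := lt_of_lt_of_le hr (min_le_left _ _)
    have hrv : r < c - 1 := lt_of_lt_of_le hr (min_le_right _ _)
    have hr' : r + 1 < c := by omega
    have hrest : ∀ y ∈ [c, e, f, g], c ≤ y := by
      intro y hy
      simp only [List.mem_cons, List.mem_nil_iff, or_false] at hy
      omega
    rcases hchainP r (by omega) with h | h
    · exact Or.inl (testBit_pairFold_of_mem (memP_prefix (l₁ := [0, a, b]) (l₂ := [c, e, f, g]) hrest (by omega) h))
    · exact Or.inr (testBit_pairFold_of_mem (memP_prefix (l₁ := [0, a, b]) (l₂ := [c, e, f, g]) hrest hr' h))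
  have pre4 : ((List.foldr (fun x acc => List.foldr (fun y acc => acc ||| 2 ^ (x + y)) acc [0, a, b, c]) 0 [0, a, b, c] ||| List.foldr (fun x acc => List.foldr (fun y acc => acc ||| 2 ^ (x + y)) acc [0, a, b, c]) 0 [0, a, b, c] / 2) % 2 ^ (min 40 (e - 1)) = 2 ^ (min 40 (e - 1)) - 1) := by
    apply maskAlive_of_testBit
    intro r hr
    have hrT : r < 40 := lt_of_lt_of_le hr (min_le_left _ _)
    have hrv : r < e - 1 := lt_of_lt_of_le hr (min_le_right _ _)
    have hr' : r + 1 < e := by omega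
    have hrest : ∀ y ∈ [e, f, g], e ≤ y := by
      intro y hy
      simp only [List.mem_cons, List.mem_nil_iff, or_false] at hy
      omega
    rcases hchainP r (by omega) with h | h
    · exact Or.inl (testBit_pairFold_of_mem (memP_prefix (l₁ := [0, a, b, c]) (l₂ := [e, f, g]) hrest (by omega) h))
    · exact Or.inr (testBit_pairFold_of_mem (memP_prefix (l₁ := [0, a, b, c]) (l₂ := [e, f, g]) hrest hr' h))
  have pre5 : ((List.foldr (fun x acc => List.foldr (fun y acc => acc ||| 2 ^ (x + y)) acc [0, a, b, c, e]) 0 [0, a, b, c, e] ||| List.foldr (fun x acc => List.foldr (fun y acc => acc ||| 2 ^ (x + y)) acc [0, a, b, c, e]) 0 [0, a, b, c, e] / 2) % 2 ^ (min 40 (f - 1)) = 2 ^ (min 40 (f - 1)) - 1) := by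
    apply maskAlive_of_testBit
    intro r hr
    have hrT : r < 40 := lt_of_lt_of_le hr (min_le_left _ _)
    have hrv : r < f - 1 := lt_of_lt_of_le hr (min_le_right _ _)
    have hr' : r + 1 < f := by omega
    have hrest : ∀ y ∈ [f, g], f ≤ y := by
      intro y hy
      simp only [List.mem_cons, List.mem_nil_iff, or_false] at hy
      omega
    rcases hchainP r (by omega) with h | h
    · exact Or.inl (testBit_pairFold_of_mem (memP_prefix (l₁ := [0, a, b, c, e]) (l₂ := [f, g]) hrest (by omega) h))
    · exact Or.inr (testBit_pairFold_of_mem (memP_prefix (l₁ := [0, a, b, c, e]) (l₂ := [f, g]) hrest hr' h))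
  have pre6 : ((List.foldr (fun x acc => List.foldr (fun y acc => acc ||| 2 ^ (x + y)) acc [0, a, b, c, e, f]) 0 [0, a, b, c, e, f] ||| List.foldr (fun x acc => List.foldr (fun y acc => acc ||| 2 ^ (x + y)) acc [0, a, b, c, e, f]) 0 [0, a, b, c, e, f] / 2) % 2 ^ (min 40 (g - 1)) = 2 ^ (min 40 (g - 1)) - 1) := by
    apply maskAlive_of_testBit
    intro r hr
    have hrT : r < 40 := lt_of_lt_of_le hr (min_le_left _ _)
    have hrv : r < g - 1 := lt_of_lt_of_le hr (min_le_right _ _)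
    have hr' : r + 1 < g := by omega
    have hrest : ∀ y ∈ [g], g ≤ y := by
      intro y hy
      simp only [List.mem_cons, List.mem_nil_iff, or_false] at hy
      omega
    rcases hchainP r (by omega) with h | h
    · exact Or.inl (testBit_pairFold_of_mem (memP_prefix (l₁ := [0, a, b, c, e, f]) (l₂ := [g]) hrest (by omega) h))
    · exact Or.inr (testBit_pairFold_of_mem (memP_prefix (l₁ := [0, a, b, c, e, f]) (l₂ := [g]) hrest hr' h))
  -- apply the kernel check
  obtain ⟨hnoT1, hnoT0T2⟩ := sectorCheck_two_seven a (hmemR a (by simp)) ⟨h0, pre1⟩ b (hmemR b (by simp)) ⟨hlt1, pre2⟩ c (hmemR c (by simp)) ⟨hlt2, pre3⟩ e (hmemR e (by simp)) ⟨hlt3, pre4⟩ f (hmemR f (by simp)) ⟨hlt4, pre5⟩ g (hmemR g (by simp)) ⟨hlt5, pre6⟩ hfull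
  -- bit tests back to membership
  have hbit : ∀ r, r ≤ 42 → (∃ i j : Fin 7, d i + d j = r) → (List.foldr (fun x acc => List.foldr (fun y acc => acc ||| 2 ^ (x + y)) acc [0, a, b, c, e, f, g]) 0 [0, a, b, c, e, f, g]).testBit r = true :=
    fun r hr h => testBit_pairFold_of_mem (hmemP r hr h)
  have hcontra : ∀ r, r ≤ 42 → (∃ i j : Fin 7, d i + d j = r) → (List.foldr (fun x acc => List.foldr (fun y acc => acc ||| 2 ^ (x + y)) acc [0, a, b, c, e, f, g]) 0 [0, a, b, c, e, f, g]).testBit r = false → False := by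
    intro r hr h hf
    have hb := hbit r hr h
    rw [hf] at hb
    exact Bool.false_ne_true hb
  -- degree 41, 42, or ≥ 43: each contradicts the check
  rcases Nat.lt_or_ge (pencil d S).det.natDegree 43 with hsmall | hbig
  · interval_cases h : (pencil d S).det.natDegree
    · exact hcontra 41 (by omega) (h ▸ htop) hnoT1
    · rcases hchain 40 (by omega) with h' | h'
      · rcases hnoT0T2 with hf | hf
        · exact hcontra 40 (by omega) h' hf
        · exact hcontra 42 (by omega) (h ▸ htop) hf
      · exact hcontra 41 (by omega) h' hnoT1
  · rcases hchain 40 (by omega) with h1 | h1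
    · rcases hchain 41 (by omega) with h2 | h2
      · exact hcontra 41 (by omega) h2 hnoT1
      · rcases hnoT0T2 with hf | hf
        · exact hcontra 40 (by omega) h1 hf
        · exact hcontra 42 (by omega) h2 hf
    · exact hcontra 41 (by omega) h1 hnoT1

end Summit.ValiantsHypothesis.ValiantsHypothesis.Theorems.LacunarySymmetroidMatrixDescartes.FiniteSector
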